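import Mathlib
import Literature.MathematicalPhysics.StatisticalMechanics.BarlowStacking
import Summits.AtomisticToContinuum.Crystallization.Theorems.BraggSlacknessRigidityHcpDiffractionRigidityEssentialPeriodicityRatAux4

/-!
# The arithmetic lemma of the incommensurate case (stub `stub_essentialPeriodicityIrratArith` of
# crux `HcpDiffractionRigidity`, item `stmt-AtomisticToContinuum-13166`)

Pure arithmetic of the hcp template with `h²/a² ∉ ℚ`:

* `hcp_dual_norm_sq_irrat` — every vector `k` of the dual `L*` of the hcp period lattice
  `ℤ(a,0,0) + ℤ(a/2, a√3/2, 0) + ℤ(0,0,2h)` has `12 a² h² |k|² = N · 4h² + N' · 3a²` with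
  `N, N' ∈ ℕ` (`a k₀ = n₀`, `a√3 k₁ = 2n₁ − n₀`, `2h k₂ = n₂`, `N = 3n₀² + (2n₁ − n₀)²`,
  `N' = n₂²`);
* `int_coeff_unique` — since `h² ∉ ℚ a²`, the pair `(N, N')` in `N · 4h² + N' · 3a²` is unique;
* `coeff_of_forall_sq` — if a quadratic `Q₀ + i X + i² Y` (`i ∈ ℤ`) takes only values
  `N s + N' t` with `N, N' ≥ 0` and unique coefficients, and `Y ∈ ℤ s`, then `X ∈ ℤ s`
  (the `t`-coefficient is affine in `i` and non-negative on `ℤ`, hence constant);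
* `exists_int_of_forall_not_admissible_irrat` — THE ARITHMETIC LEMMA: for a `ℤ`-module `M₂ ⊥ v`
  with `D⟨u,w⟩ ∈ a²ℤ` on `M₂` and `D|v|² ∈ h²ℤ`, if `ξ + (D/a²)b + (Dj/h²)v` lies in the Bragg set
  `{0} ∪ ⋃_{k ∈ L*} {|η| = |k|}` for all `b ∈ M₂`, `j ∈ ℤ`, then `6D⟨ξ,b⟩ ∈ ℤ` (`b ∈ M₂`),
  `8D⟨ξ,v⟩ ∈ ℤ`, hence `24D⟨ξ, z + jv⟩ ∈ ℤ`.

All `[folklore]`.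
-/

noncomputable section

namespace Summit.AtomisticToContinuum.Crystallization.Theorems

namespace HcpRigidityIrratArith

open scoped BigOperators Real RealInnerProductSpace
open Literature.MathematicalPhysics.StatisticalMechanics
open HcpRigiditySpectral

/-! ## Squared norms of hcp dual vectors -/

/-- **Squared norms of hcp dual vectors.** If `⟨k, g⟩ ∈ ℤ` for every `g` in the hcp period
lattice, then `12 a² h² |k|² = N · 4h² + N' · 3a²` with integers `N, N' ≥ 0`. [folklore] -/
theorem hcp_dual_norm_sq_irrat {a h : ℝ} (ha : a ≠ 0) (hh : h ≠ 0)
    {k : EuclideanSpace ℝ (Fin 3)}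
    (hk : ∀ g ∈ (hcpPeriodicConfiguration ha hh).lattice, ∃ n : ℤ, ⟪k, g⟫ = (n : ℝ)) :
    ∃ N N' : ℤ, 0 ≤ N ∧ 0 ≤ N' ∧
      12 * a ^ 2 * h ^ 2 * ‖k‖ ^ 2 = N * (4 * h ^ 2) + N' * (3 * a ^ 2) := by
  obtain ⟨hu, hv, ht⟩ := mem_hcp_lattice ha hh
  obtain ⟨n₀, hn₀⟩ := hk _ hu
  obtain ⟨n₁, hn₁⟩ := hk _ hv
  obtain ⟨n₂, hn₂⟩ := hk _ ht
  have hw0 : haggWindow alternatingHagg 0 2 = 0 := by rw [haggWindow_alternating]; decide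
  have e₀ : a * k 0 = n₀ := by
    rw [← hn₀]; simp [triangularVec₁, PiLp.inner_apply, Fin.sum_univ_three]
  have e₁ : a / 2 * k 0 + a * √3 / 2 * k 1 = n₁ := by
    rw [← hn₁]; simp [triangularVec₂, PiLp.inner_apply, Fin.sum_univ_three]
  have e₂ : 2 * h * k 2 = n₂ := by
    rw [← hn₂]; simp [hw0, layerNormal, PiLp.inner_apply, Fin.sum_univ_three]
  have hnorm : ‖k‖ ^ 2 = k 0 ^ 2 + k 1 ^ 2 + k 2 ^ 2 := by
    rw [EuclideanSpace.real_norm_sq_eq, Fin.sum_univ_three]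
  have h3 : (√3 : ℝ) ^ 2 = 3 := Real.sq_sqrt (by norm_num)
  have e₁' : a * √3 * k 1 = 2 * n₁ - n₀ := by linear_combination 2 * e₁ - e₀
  refine ⟨3 * n₀ ^ 2 + (2 * n₁ - n₀) ^ 2, n₂ ^ 2, by positivity, by positivity, ?_⟩
  rw [hnorm]
  push_cast
  linear_combination (12 * h ^ 2 * (a * k 0 + n₀)) * e₀ +
    (4 * h ^ 2 * (a * √3 * k 1 + (2 * n₁ - n₀))) * e₁' +
    (-(4 * h ^ 2 * a ^ 2 * k 1 ^ 2)) * h3 + (3 * a ^ 2 * (2 * h * k 2 + n₂)) * e₂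

/-- Squared norms on the Bragg set: if `η = 0` or `|η| = |k|` for a dual vector `k`, then
`12 a² h² |η|² = N · 4h² + N' · 3a²` with integers `N, N' ≥ 0`. [folklore] -/
theorem exists_norm_sq_of_not_admissible {a h : ℝ} (ha : a ≠ 0) (hh : h ≠ 0)
    {η : EuclideanSpace ℝ (Fin 3)}
    (hη : ¬ (η ≠ 0 ∧ ∀ k : EuclideanSpace ℝ (Fin 3),
      (∀ g ∈ (hcpPeriodicConfiguration ha hh).lattice, ∃ n : ℤ, ⟪k, g⟫ = (n : ℝ)) → ‖η‖ ≠ ‖k‖)) :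
    ∃ N N' : ℤ, 0 ≤ N ∧ 0 ≤ N' ∧
      12 * a ^ 2 * h ^ 2 * ‖η‖ ^ 2 = N * (4 * h ^ 2) + N' * (3 * a ^ 2) := by
  by_cases h0 : η = 0
  · exact ⟨0, 0, le_rfl, le_rfl, by rw [h0, norm_zero]; simp⟩
  · simp only [not_and, not_forall, not_not, exists_prop] at hη
    obtain ⟨k, hk, hηk⟩ := hη h0
    rw [hηk]
    exact hcp_dual_norm_sq_irrat ha hh hk

/-! ## Uniqueness of the coefficients -/

/-- **`ℚ`-independence of `h²` and `a²`.** If `h² ∉ ℚ a²` (and `a ≠ 0`), then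
`N · 4h² + N' · 3a² = M · 4h² + M' · 3a²` with integers `N, N', M, M'` forces `N = M` and
`N' = M'`. [folklore] -/
theorem int_coeff_unique {a h : ℝ} (ha : a ≠ 0) (hirr : ¬ ∃ q : ℚ, h ^ 2 = (q : ℝ) * a ^ 2)
    (N N' M M' : ℤ)
    (heq : (N : ℝ) * (4 * h ^ 2) + N' * (3 * a ^ 2) = M * (4 * h ^ 2) + M' * (3 * a ^ 2)) :
    N = M ∧ N' = M' := by
  have ha2 : a ^ 2 ≠ 0 := pow_ne_zero 2 ha
  by_cases hNM : N = M
  · subst hNM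
    refine ⟨rfl, ?_⟩
    have h3 : (3 * a ^ 2) * ((N' : ℝ) - M') = 0 := by linear_combination heq
    have h3a : (3 : ℝ) * a ^ 2 ≠ 0 := mul_ne_zero three_ne_zero ha2
    exact_mod_cast sub_eq_zero.1 ((mul_eq_zero.1 h3).resolve_left h3a)
  · exfalso
    apply hirr
    have hNM' : ((N : ℝ) - M) ≠ 0 := by
      rw [sub_ne_zero]; exact_mod_cast hNM
    have h4 : (4 : ℝ) * (N - M) ≠ 0 := mul_ne_zero four_ne_zero hNM'
    refine ⟨(3 * (M' - N') : ℚ) / (4 * (N - M)), ?_⟩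
    push_cast
    rw [div_mul_eq_mul_div, eq_div_iff h4]
    linear_combination heq

/-- The swapped form of `int_coeff_unique`: coefficients of `N · 3a² + N' · 4h²` are unique.
[folklore] -/
theorem int_coeff_unique' {a h : ℝ} (ha : a ≠ 0) (hirr : ¬ ∃ q : ℚ, h ^ 2 = (q : ℝ) * a ^ 2)
    (N N' M M' : ℤ)
    (heq : (N : ℝ) * (3 * a ^ 2) + N' * (4 * h ^ 2) = M * (3 * a ^ 2) + M' * (4 * h ^ 2)) :
    N = M ∧ N' = M' :=
  (int_coeff_unique ha hirr N' N M' M (by linear_combination heq)).symm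

/-! ## Non-negative affine functions on `ℤ` are constant -/

/-- If `N ≥ 0` and both `N + (N+1)B ≥ 0` and `N − (N+1)B ≥ 0`, then `B = 0`. [folklore] -/
theorem int_eq_zero_of_nonneg {N B : ℤ} (hN : 0 ≤ N) (h₁ : 0 ≤ N + (N + 1) * B)
    (h₂ : 0 ≤ N + -(N + 1) * B) : B = 0 := by
  rcases lt_trichotomy B 0 with hB | hB | hB
  · have hB1 : B ≤ -1 := by omega
    have := mul_le_mul_of_nonneg_left hB1 (show (0 : ℤ) ≤ N + 1 by linarith)
    linarith
  · exact hB
  · have hB1 : 1 ≤ B := by omega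
    have := mul_le_mul_of_nonneg_left hB1 (show (0 : ℤ) ≤ N + 1 by linarith)
    linarith

/-- **The affine trick.** Suppose the coefficients in `N s + N' t` (`N, N' ∈ ℤ`) are unique, a
quadratic `i ↦ Q₀ + i X + i² Y` on `ℤ` takes only values `N s + N' t` with `N, N' ≥ 0`, and
`Y ∈ ℤ s`. Then `X ∈ ℤ s`: the `t`-coefficient of `Q₀ + i X + i² Y` is affine in `i` and
non-negative for every `i ∈ ℤ`, hence constant. [folklore] -/
theorem coeff_of_forall_sq {s t Q₀ X Y : ℝ}
    (huniq : ∀ N N' M M' : ℤ, (N : ℝ) * s + N' * t = M * s + M' * t → N = M ∧ N' = M')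
    (hQ : ∀ i : ℤ, ∃ N N' : ℤ, 0 ≤ N ∧ 0 ≤ N' ∧ Q₀ + i * X + (i : ℝ) ^ 2 * Y = N * s + N' * t)
    {y : ℤ} (hY : Y = y * s) : ∃ A : ℤ, X = A * s := by
  obtain ⟨N₀, N₀', -, hN₀', hQ₀⟩ := hQ 0
  obtain ⟨N₁, N₁', -, -, hQ₁⟩ := hQ 1
  obtain ⟨A, B, hX⟩ : ∃ A B : ℤ, X = A * s + B * t :=
    ⟨N₁ - N₀ - y, N₁' - N₀', by push_cast at hQ₀ hQ₁ ⊢; linear_combination hQ₁ - hQ₀ - hY⟩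
  have hi : ∀ i : ℤ, 0 ≤ N₀' + i * B := by
    intro i
    obtain ⟨Ni, Ni', -, hNi', hQi⟩ := hQ i
    have key := huniq (N₀ + i * A + i ^ 2 * y) (N₀' + i * B) Ni Ni'
      (by push_cast at hQ₀ ⊢
          linear_combination hQi - hQ₀ - (i : ℝ) * hX - (i : ℝ) ^ 2 * hY)
    rw [key.2]; exact hNi'
  have hB0 : B = 0 := int_eq_zero_of_nonneg hN₀' (hi (N₀' + 1)) (hi (-(N₀' + 1)))
  refine ⟨A, ?_⟩
  rw [hX, hB0]; push_cast; ring

/-! ## The arithmetic lemma -/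

/-- **In-plane integrality.** With `h² ∉ ℚa²`, `D|b|² = n_b a²` (`n_b ∈ ℤ`): if
`ξ + (D i/a²) b` lies in the Bragg set for every `i ∈ ℤ`, then `6D⟨ξ, b⟩ ∈ ℤ`
(precisely `24 D h² ⟨ξ,b⟩ ∈ ℤ · 4h²`). [folklore] -/
theorem inPlane_integral {a h : ℝ} (ha : a ≠ 0) (hh : h ≠ 0)
    (hirr : ¬ ∃ q : ℚ, h ^ 2 = (q : ℝ) * a ^ 2) {D : ℕ} {ξ b : EuclideanSpace ℝ (Fin 3)} {nb : ℤ}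
    (hnb : (D : ℝ) * ‖b‖ ^ 2 = nb * a ^ 2)
    (hB : ∀ i : ℤ, ¬ (ξ + ((D : ℝ) / a ^ 2) • (i : ℝ) • b ≠ 0 ∧ ∀ k : EuclideanSpace ℝ (Fin 3),
      (∀ g ∈ (hcpPeriodicConfiguration ha hh).lattice, ∃ n : ℤ, ⟪k, g⟫ = (n : ℝ)) →
        ‖ξ + ((D : ℝ) / a ^ 2) • (i : ℝ) • b‖ ≠ ‖k‖)) :
    ∃ A : ℤ, 24 * (D : ℝ) * h ^ 2 * ⟪ξ, b⟫ = A * (4 * h ^ 2) := by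
  refine coeff_of_forall_sq (Q₀ := 12 * a ^ 2 * h ^ 2 * ‖ξ‖ ^ 2)
    (Y := ((3 * D * nb : ℤ) : ℝ) * (4 * h ^ 2)) (int_coeff_unique ha hirr) ?_ rfl
  intro i
  obtain ⟨N, N', hN, hN', hQ⟩ := exists_norm_sq_of_not_admissible ha hh (hB i)
  refine ⟨N, N', hN, hN', ?_⟩
  rw [← hQ, smul_smul, norm_add_sq_real, real_inner_smul_right, norm_smul, mul_pow,
    Real.norm_eq_abs, sq_abs]
  have hc : a ^ 2 * ((D : ℝ) / a ^ 2 * (i : ℝ)) = D * i := by field_simp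
  push_cast
  linear_combination
    (-(24 * h ^ 2 * ⟪ξ, b⟫ + 12 * h ^ 2 * ((D : ℝ) / a ^ 2 * (i : ℝ)) * ‖b‖ ^ 2 +
      12 * h ^ 2 * (i : ℝ) * (nb : ℝ))) * hc -
    (12 * h ^ 2 * ((D : ℝ) / a ^ 2 * (i : ℝ)) * (i : ℝ)) * hnb

/-- **Vertical integrality.** With `h² ∉ ℚa²`, `D|v|² = n_v h²` (`n_v ∈ ℤ`): if
`ξ + (D j/h²) v` lies in the Bragg set for every `j ∈ ℤ`, then `8D⟨ξ, v⟩ ∈ ℤ`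
(precisely `24 D a² ⟨ξ,v⟩ ∈ ℤ · 3a²`). [folklore] -/
theorem vertical_integral {a h : ℝ} (ha : a ≠ 0) (hh : h ≠ 0)
    (hirr : ¬ ∃ q : ℚ, h ^ 2 = (q : ℝ) * a ^ 2) {D : ℕ} {ξ v : EuclideanSpace ℝ (Fin 3)} {nv : ℤ}
    (hnv : (D : ℝ) * ‖v‖ ^ 2 = nv * h ^ 2)
    (hB : ∀ j : ℤ, ¬ (ξ + ((D : ℝ) * (j : ℝ) / h ^ 2) • v ≠ 0 ∧ ∀ k : EuclideanSpace ℝ (Fin 3),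
      (∀ g ∈ (hcpPeriodicConfiguration ha hh).lattice, ∃ n : ℤ, ⟪k, g⟫ = (n : ℝ)) →
        ‖ξ + ((D : ℝ) * (j : ℝ) / h ^ 2) • v‖ ≠ ‖k‖)) :
    ∃ B : ℤ, 24 * (D : ℝ) * a ^ 2 * ⟪ξ, v⟫ = B * (3 * a ^ 2) := by
  refine coeff_of_forall_sq (Q₀ := 12 * a ^ 2 * h ^ 2 * ‖ξ‖ ^ 2)
    (Y := ((4 * D * nv : ℤ) : ℝ) * (3 * a ^ 2)) (int_coeff_unique' ha hirr) ?_ rfl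
  intro j
  obtain ⟨N, N', hN, hN', hQ⟩ := exists_norm_sq_of_not_admissible ha hh (hB j)
  refine ⟨N', N, hN', hN, ?_⟩
  rw [add_comm ((N' : ℝ) * _), ← hQ, norm_add_sq_real, real_inner_smul_right, norm_smul, mul_pow,
    Real.norm_eq_abs, sq_abs]
  have hc : h ^ 2 * ((D : ℝ) * (j : ℝ) / h ^ 2) = D * j := by field_simp
  push_cast
  linear_combination
    (-(24 * a ^ 2 * ⟪ξ, v⟫ + 12 * a ^ 2 * ((D : ℝ) * (j : ℝ) / h ^ 2) * ‖v‖ ^ 2 +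
      12 * a ^ 2 * (j : ℝ) * (nv : ℝ))) * hc -
    (12 * a ^ 2 * ((D : ℝ) * (j : ℝ) / h ^ 2) * (j : ℝ)) * hnv

/-- **The arithmetic lemma (incommensurate case).** For the hcp template with `h² ∉ ℚ a²`, a
`ℤ`-module `M₂ ⊥ v` with `D⟨u,w⟩ ∈ a²ℤ` on `M₂` and `D|v|² ∈ h²ℤ`: if
`ξ + (D/a²)b + (Dj/h²)v` lies in the Bragg set `{0} ∪ ⋃_{k ∈ L*} {|η| = |k|}` for all `b ∈ M₂`,
`j ∈ ℤ`, then `24D⟨ξ, z + jv⟩ ∈ ℤ` for all `z ∈ M₂`, `j ∈ ℤ`. [folklore] -/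
theorem exists_int_of_forall_not_admissible_irrat {a h : ℝ} (ha : a ≠ 0) (hh : h ≠ 0)
    (hirr : ¬ ∃ q : ℚ, h ^ 2 = (q : ℝ) * a ^ 2)
    {M₂ : Submodule ℤ (EuclideanSpace ℝ (Fin 3))} {v : EuclideanSpace ℝ (Fin 3)} {D : ℕ}
    (hGram : ∀ u ∈ M₂, ∀ w ∈ M₂, ∃ n : ℤ, (D : ℝ) * ⟪u, w⟫ = (n : ℝ) * a ^ 2)
    (hv : ∃ n : ℤ, (D : ℝ) * ‖v‖ ^ 2 = (n : ℝ) * h ^ 2)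
    {ξ : EuclideanSpace ℝ (Fin 3)}
    (hξ : ∀ b ∈ M₂, ∀ j : ℤ, ¬ (ξ + ((D : ℝ) / a ^ 2) • b + ((D : ℝ) * (j : ℝ) / h ^ 2) • v ≠ 0 ∧
      ∀ k : EuclideanSpace ℝ (Fin 3),
        (∀ g ∈ (hcpPeriodicConfiguration ha hh).lattice, ∃ n : ℤ, ⟪k, g⟫ = (n : ℝ)) →
          ‖ξ + ((D : ℝ) / a ^ 2) • b + ((D : ℝ) * (j : ℝ) / h ^ 2) • v‖ ≠ ‖k‖))
    {z : EuclideanSpace ℝ (Fin 3)} (hz : z ∈ M₂) (j : ℤ) :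
    ∃ n : ℤ, ((24 * D : ℕ) : ℝ) * ⟪ξ, z + (j : ℝ) • v⟫ = (n : ℝ) := by
  have ha2 : a ^ 2 ≠ 0 := pow_ne_zero 2 ha
  have hh2 : h ^ 2 ≠ 0 := pow_ne_zero 2 hh
  -- in-plane part
  obtain ⟨nz, hnz⟩ := hGram z hz z hz
  rw [real_inner_self_eq_norm_sq] at hnz
  have hBz : ∀ i : ℤ, ¬ (ξ + ((D : ℝ) / a ^ 2) • (i : ℝ) • z ≠ 0 ∧ ∀ k : EuclideanSpace ℝ (Fin 3),
      (∀ g ∈ (hcpPeriodicConfiguration ha hh).lattice, ∃ n : ℤ, ⟪k, g⟫ = (n : ℝ)) →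
        ‖ξ + ((D : ℝ) / a ^ 2) • (i : ℝ) • z‖ ≠ ‖k‖) := by
    intro i
    have hmem : (i : ℝ) • z ∈ M₂ := by rw [Int.cast_smul_eq_zsmul ℝ i z]; exact zsmul_mem hz i
    have h0 := hξ _ hmem 0
    simpa only [Int.cast_zero, mul_zero, zero_div, zero_smul, add_zero] using h0
  obtain ⟨A, hA⟩ := inPlane_integral ha hh hirr hnz hBz
  -- vertical part
  obtain ⟨nv, hnv⟩ := hv
  have hBv : ∀ j : ℤ, ¬ (ξ + ((D : ℝ) * (j : ℝ) / h ^ 2) • v ≠ 0 ∧ ∀ k : EuclideanSpace ℝ (Fin 3),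
      (∀ g ∈ (hcpPeriodicConfiguration ha hh).lattice, ∃ n : ℤ, ⟪k, g⟫ = (n : ℝ)) →
        ‖ξ + ((D : ℝ) * (j : ℝ) / h ^ 2) • v‖ ≠ ‖k‖) := by
    intro j
    have h0 := hξ 0 M₂.zero_mem j
    simpa only [smul_zero, add_zero] using h0
  obtain ⟨B, hB⟩ := vertical_integral ha hh hirr hnv hBv
  -- conclusion
  have e1 : 24 * (D : ℝ) * ⟪ξ, z⟫ = 4 * A :=
    mul_right_cancel₀ hh2 (by linear_combination hA)
  have e2 : 24 * (D : ℝ) * ⟪ξ, v⟫ = 3 * B :=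
    mul_right_cancel₀ ha2 (by linear_combination hB)
  refine ⟨4 * A + 3 * j * B, ?_⟩
  rw [inner_add_right, real_inner_smul_right]
  push_cast
  linear_combination e1 + (j : ℝ) * e2

end HcpRigidityIrratArith

/-- **STUB B2c₂ — the split arithmetic lemma (incommensurate case).** For the hcp template with
`h²/a² ∉ ℚ`, a `ℤ`-module `M₂ ⊥ v` with `D⟨u,w⟩ ∈ a²ℤ` on `M₂` and `D|v|² ∈ h²ℤ`:
if `ξ + (D/a²)b + (Dj/h²)v` lies in the Bragg set `{0} ∪ ⋃_{k ∈ L*} {|η| = |k|}` for all `b ∈ M₂`,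
`j ∈ ℤ`, then `24D⟨ξ, z + jv⟩ ∈ ℤ` for all `z ∈ M₂`, `j ∈ ℤ`.  (Every dual vector has
`|k|² = N/(3a²) + N'/(4h²)` with `N, N' ∈ ℕ`; since `1/a², 1/h²` are `ℚ`-independent the two
components of `|ξ + m|²` are well defined, non-negative, and affine in the multiple `i ↦ i m`; an
affine function on `ℤ` with values `≥ 0` is constant, which kills the cross components and leaves
`2D⟨ξ,b⟩ ∈ (1/3)ℤ`, `2D⟨ξ,v⟩ ∈ (1/4)ℤ`.) [folklore] -/
theorem stub_essentialPeriodicityIrratArith : ∀ (a h : ℝ) (ha : a ≠ 0) (hh : h ≠ 0), ¬ (∃ q : ℚ, h ^ 2 = (q : ℝ) * a ^ 2) → ∀ (M₂ : Submodule ℤ (EuclideanSpace ℝ (Fin 3))) (v : EuclideanSpace ℝ (Fin 3)) (D : ℕ), 0 < D → (∀ u ∈ M₂, inner ℝ u v = 0) → (∀ u ∈ M₂, ∀ w ∈ M₂, ∃ n : ℤ, (D : ℝ) * inner ℝ u w = (n : ℝ) * a ^ 2) → (∃ n : ℤ, (D : ℝ) * ‖v‖ ^ 2 = (n : ℝ)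 * h ^ 2) → ∀ ξ : EuclideanSpace ℝ (Fin 3), (∀ b ∈ M₂, ∀ j : ℤ, ¬ (ξ + ((D : ℝ) / a ^ 2) • b + ((D : ℝ) * (j : ℝ) / h ^ 2) • v ≠ 0 ∧ ∀ k : EuclideanSpace ℝ (Fin 3), (∀ g ∈ (Literature.MathematicalPhysics.StatisticalMechanics.hcpPeriodicConfiguration ha hh).lattice, ∃ n : ℤ, inner ℝ k g = (n : ℝ)) → ‖ξ + ((D : ℝ) / a ^ 2) • b + ((D : ℝ) * (j : ℝ) / h ^ 2) • v‖ ≠ ‖k‖)) → ∀ z ∈ M₂, ∀ j : ℤ, ∃ n : ℤ, ((24 * D : ℕ) : ℝ) * inner ℝ ξ (z + (j : ℝ) • v) = (n : ℝ) :=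
  fun _ _ ha hh hirr _ _ _ _ _ hGram hv _ hξ _ hz j =>
    HcpRigidityIrratArith.exists_int_of_forall_not_admissible_irrat ha hh hirr hGram hv hξ hz j

end Summit.AtomisticToContinuum.Crystallization.Theorems

end
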